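import Summits.HodgeConjecture.HodgeConjecture.Theorems.K2LiuClosedSubgroupHeightBallVolume
import HarnessLib

/-!
# The height box of `GL_N(𝔸_L)`: slab decomposition and the slab measure on `GL_N(L ⊗ ℝ)`

Track B ∕ hLiu418 = stmt-HodgeConjecture-24832, line `K2_Liu_CurveThetaSigs`, unit U5 «DOUBLING ZETA», organ (IV-d) of
socket #16b `sig_K2LiuAdelicNormIntegrable`; seat `hodgecm-mathlib-K2Liu-p03` (g2), plan
`K2/K2Liu-p03/g2/PLAN-16b-AdelicNormIntegrable.v2.K2Liu-p03-g2.md`, FILE 5′ of the plan (between ★ FILE 5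
`Theorems/K2LiuClosedSubgroupHeightBallVolume` and the #16b head).

★ FILE 5 bounds the Haar volume of a height ball of a closed subgroup of `GL_N(𝔸_L)` by the Haar volume `μ` of a HEIGHT BOX
`{y : H_∞(y) ≤ A ∧ ∏_v H_v(y) ≤ B}` of `GL_N(𝔸_L)`. This file reduces that volume to the two factor problems solved by the crew
files (2) `K2LiuArchHeightBallVolume` (K2Liu-p07) and (4) `K2LiuFiniteHeightCosetCount` (K2Liu-p02), WITHOUT a product decomposition
of the Haar measure of `GL_N(𝔸_L)` (the trick of ★ `HarishChandraConvolutionAdelic.levelArchMeasure`):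

* §1 `archHeight_ofFinite_mul`, `archHeight_ofInfinite_toMixed` — `H_∞` only sees the archimedean component.
* §2 `measure_heightBox_le_card_mul_measure_slab` — **slab decomposition**: if the finite height ball `{∏_v H_v ≤ B}` is covered by
  the cosets `c · GL_N(𝒪̂)`, `c ∈ s` (`s` finite), then `μ{H_∞ ≤ A ∧ ∏ H_v ≤ B} ≤ #s · μ(Slab A)` with the SLAB
  `Slab A = {y : H_∞(y) ≤ A ∧ y_f ∈ GL_N(𝒪̂)}` (each piece is the left translate `(1, c) · Slab A`; left invariance of `μ`).
* §3 `map_toMixed_restrict_apply`, `isMulLeftInvariant_∕isFiniteMeasureOnCompacts_∕isOpenPosMeasure_map_toMixed_restrict`,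
  `isHaarMeasure_map_toMixed_restrict` — **the slab measure** `(g ↦ g_∞)_* (μ|_{y_f ∈ GL_N(𝒪̂)})` IS a Haar measure on
  `GL_N(L ⊗ ℝ)` (left invariance from `(x, 1) · {y_f ∈ GL_N(𝒪̂)} = {y_f ∈ GL_N(𝒪̂)}`; finite on compacts because
  `{y_∞ ∈ C, y_f ∈ GL_N(𝒪̂)} ⊆ (C, 1) · (1, GL_N(𝒪̂))` is compact, ★ `isCompact_glFiniteIntegralLevel_holds`; positive on opens);
  `measure_slab_eq_map` — `μ(Slab A) = ((g ↦ g_∞)_* μ|)({x : H_∞(x) ≤ A})`, an archimedean height ball.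

No definition, no instance, no named fact; axioms ⊆ {propext, Classical.choice, Quot.sound}.

## References
* A. Borel, H. Jacquet, *Automorphic forms and automorphic representations*, PSPM 33.1 (1979), §1.2, §4.1 [BorelJacquet1979].
* A. Weil, *Basic Number Theory* (1967), Ch. VII §3 [WeilBNT1967].

HONEST LABEL: HC_CM is proved only modulo the 7 printed citations (2 remaining named inputs: hLiu418 =
stmt-HodgeConjecture-24832, h413 = stmt-HodgeConjecture-24833) until rung 0 closes; this helper moves no counter.
-/

noncomputable section

set_option autoImplicit false

set_option linter.dupNamespace false

open MeasureTheory Set Filter Topology NumberField NumberField.mixedEmbedding IsDedekindDomain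
open scoped ENNReal NNReal Pointwise RestrictedProduct

namespace Summit.HodgeConjecture.HodgeConjecture.Cruxes.HLiu418.K2LiuAdelicHeightBoxVolume

open Literature.NumberTheory.Automorphic

variable {N : ℕ} {L : Type} [Field L] [NumberField L]

/-! ## §1 `H_∞` only sees the archimedean component -/

/-- `H_∞((1, h) · y) = H_∞(y)`: the archimedean component of `(1, h) y` is that of `y` (★ `GLn.toMixed_ofFinite`).
[cite: BorelJacquet1979, §4.1] -/
theorem archHeight_ofFinite_mul (h : GL (Fin N) (FiniteAdeleRing (𝓞 L) L)) (y : GL (Fin N) (AdeleRing (𝓞 L) L)) :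
    GLn.archHeight N L (GLn.ofFinite N L h * y) = GLn.archHeight N L y := by
  unfold GLn.archHeight
  rw [map_mul, GLn.toMixed_ofFinite, one_mul]

/-- `H_∞((y_∞, 1)) = H_∞(y)` (★ `GLn.toMixed_ofInfinite`). [cite: BorelJacquet1979, §4.1] -/
theorem archHeight_ofInfinite_toMixed (y : GL (Fin N) (AdeleRing (𝓞 L) L)) :
    GLn.archHeight N L (GLn.ofInfinite N L (GLn.toMixed N L y)) = GLn.archHeight N L y := by
  unfold GLn.archHeight
  rw [GLn.toMixed_ofInfinite]

/-- The finite component of `(1, h) · y` is `h · y_f` (★ `GLn.sndHom_ofFinite`). [cite: BorelJacquet1979, §4.1] -/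
theorem sndHom_ofFinite_mul (h : GL (Fin N) (FiniteAdeleRing (𝓞 L) L)) (y : GL (Fin N) (AdeleRing (𝓞 L) L)) :
    GLn.sndHom N L (GLn.ofFinite N L h * y) = h * GLn.sndHom N L y := by
  rw [map_mul, GLn.sndHom_ofFinite]

/-! ## §2 Slab decomposition of the height box -/

/-- **Slab decomposition.** Let `μ` be a left invariant measure on `GL_N(𝔸_L)`, `s ⊆ GL_N(𝔸_{L,f})` finite, `A, B` real. If every
`y` with `∏_v H_v(y) ≤ B` has `c⁻¹ y_f ∈ GL_N(𝒪̂)` for some `c ∈ s` (the finite height ball is covered by the cosets `c · GL_N(𝒪̂)`),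
then `μ{y : H_∞(y) ≤ A ∧ ∏_v H_v(y) ≤ B} ≤ #s · μ{y : H_∞(y) ≤ A ∧ y_f ∈ GL_N(𝒪̂)}`: the box is covered by the `#s` left
translates `(1, c) · Slab A`, each of measure `μ(Slab A)`. [cite: BorelJacquet1979, §1.2] [cite: WeilBNT1967, Ch. VII §3] -/
theorem measure_heightBox_le_card_mul_measure_slab
    [MeasurableSpace (GL (Fin N) (AdeleRing (𝓞 L) L))] [MeasurableMul (GL (Fin N) (AdeleRing (𝓞 L) L))]
    (μ : Measure (GL (Fin N) (AdeleRing (𝓞 L) L))) [μ.IsMulLeftInvariant]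
    (s : Finset (GL (Fin N) (FiniteAdeleRing (𝓞 L) L))) (A B : ℝ)
    (hcover : ∀ y : GL (Fin N) (AdeleRing (𝓞 L) L), ∏ᶠ v, (GLn.localHeight N L v y : ℝ) ≤ B →
      ∃ c ∈ s, c⁻¹ * GLn.sndHom N L y ∈ glFiniteIntegralLevel N L) :
    μ {y | (GLn.archHeight N L y : ℝ) ≤ A ∧ ∏ᶠ v, (GLn.localHeight N L v y : ℝ) ≤ B} ≤
      s.card * μ {y | (GLn.archHeight N L y : ℝ) ≤ A ∧ GLn.sndHom N L y ∈ glFiniteIntegralLevel N L} := by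
  classical
  set Slab : Set (GL (Fin N) (AdeleRing (𝓞 L) L)) :=
    {y | (GLn.archHeight N L y : ℝ) ≤ A ∧ GLn.sndHom N L y ∈ glFiniteIntegralLevel N L} with hSlab
  -- the pieces `(1, c) · Slab`
  have hsub : {y | (GLn.archHeight N L y : ℝ) ≤ A ∧ ∏ᶠ v, (GLn.localHeight N L v y : ℝ) ≤ B} ⊆
      ⋃ c ∈ s, (fun y => GLn.ofFinite N L c⁻¹ * y) ⁻¹' Slab := by
    intro y hy
    obtain ⟨c, hc, hcy⟩ := hcover y hy.2
    refine mem_iUnion₂.2 ⟨c, hc, ?_⟩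
    show GLn.ofFinite N L c⁻¹ * y ∈ Slab
    refine ⟨?_, ?_⟩
    · rw [archHeight_ofFinite_mul]; exact hy.1
    · rw [sndHom_ofFinite_mul]; exact hcy
  calc μ {y | (GLn.archHeight N L y : ℝ) ≤ A ∧ ∏ᶠ v, (GLn.localHeight N L v y : ℝ) ≤ B}
      ≤ μ (⋃ c ∈ s, (fun y => GLn.ofFinite N L c⁻¹ * y) ⁻¹' Slab) := measure_mono hsub
    _ ≤ ∑ c ∈ s, μ ((fun y => GLn.ofFinite N L c⁻¹ * y) ⁻¹' Slab) := measure_biUnion_finset_le _ _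
    _ = ∑ _c ∈ s, μ Slab := Finset.sum_congr rfl fun c _ => measure_preimage_mul μ _ _
    _ = s.card * μ Slab := by rw [Finset.sum_const, nsmul_eq_mul]

/-! ## §3 The slab measure on `GL_N(L ⊗ ℝ)` is a Haar measure -/

/-- The level set `{y : y_f ∈ GL_N(𝒪̂)}` is open. [cite: BorelJacquet1979, §4.1] -/
theorem isOpen_setOf_sndHom_mem :
    IsOpen {y : GL (Fin N) (AdeleRing (𝓞 L) L) | GLn.sndHom N L y ∈ glFiniteIntegralLevel N L} :=
  (isOpen_glFiniteIntegralLevel N L).preimage GLn.continuous_sndHom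

/-- `{y : y_∞ ∈ C, y_f ∈ GL_N(𝒪̂)}` is compact for compact `C ⊆ GL_N(L ⊗ ℝ)`: it is the image of `C × GL_N(𝒪̂)` under
`(x, h) ↦ (x, 1)(1, h)` (★ `GLn.ofInfinite_toMixed_mul_ofFinite_sndHom`, ★ `isCompact_glFiniteIntegralLevel_holds`). [cite: BorelJacquet1979, §4.1] -/
theorem isCompact_setOf_toMixed_mem_sndHom_mem {C : Set (GL (Fin N) (mixedSpace L))} (hC : IsCompact C) :
    IsCompact {y : GL (Fin N) (AdeleRing (𝓞 L) L) |
      GLn.toMixed N L y ∈ C ∧ GLn.sndHom N L y ∈ glFiniteIntegralLevel N L} := by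
  have himage : {y : GL (Fin N) (AdeleRing (𝓞 L) L) |
      GLn.toMixed N L y ∈ C ∧ GLn.sndHom N L y ∈ glFiniteIntegralLevel N L} =
      (fun p : GL (Fin N) (mixedSpace L) × GL (Fin N) (FiniteAdeleRing (𝓞 L) L) =>
        GLn.ofInfinite N L p.1 * GLn.ofFinite N L p.2) ''
        (C ×ˢ (glFiniteIntegralLevel N L : Set (GL (Fin N) (FiniteAdeleRing (𝓞 L) L)))) := by
    ext y
    constructor
    · rintro ⟨h1, h2⟩
      exact ⟨(GLn.toMixed N L y, GLn.sndHom N L y), mk_mem_prod h1 h2, GLn.ofInfinite_toMixed_mul_ofFinite_sndHom y⟩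
    · rintro ⟨p, hp, rfl⟩
      rw [mem_prod] at hp
      refine ⟨?_, ?_⟩
      · show GLn.toMixed N L (GLn.ofInfinite N L p.1 * GLn.ofFinite N L p.2) ∈ C
        rw [map_mul, GLn.toMixed_ofInfinite, GLn.toMixed_ofFinite, mul_one]; exact hp.1
      · show GLn.sndHom N L (GLn.ofInfinite N L p.1 * GLn.ofFinite N L p.2) ∈ glFiniteIntegralLevel N L
        rw [map_mul, GLn.sndHom_ofInfinite, GLn.sndHom_ofFinite, one_mul]; exact hp.2
  rw [himage]
  exact (hC.prod (isCompact_glFiniteIntegralLevel_holds N L)).image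
    (((GLn.continuous_ofInfinite N L).comp continuous_fst).mul ((GLn.continuous_ofFinite N L).comp continuous_snd))

/-- The value of the slab measure on a measurable set: `((y ↦ y_∞)_* μ|)(A) = μ({y_∞ ∈ A} ∩ {y_f ∈ GL_N(𝒪̂)})`.
[cite: BorelJacquet1979, §4.1] -/
theorem map_toMixed_restrict_apply
    [MeasurableSpace (GL (Fin N) (AdeleRing (𝓞 L) L))] [BorelSpace (GL (Fin N) (AdeleRing (𝓞 L) L))]
    [MeasurableSpace (GL (Fin N) (mixedSpace L))] [BorelSpace (GL (Fin N) (mixedSpace L))]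
    (μ : Measure (GL (Fin N) (AdeleRing (𝓞 L) L))) {A : Set (GL (Fin N) (mixedSpace L))} (hA : MeasurableSet A) :
    Measure.map (GLn.toMixed N L) (μ.restrict {y | GLn.sndHom N L y ∈ glFiniteIntegralLevel N L}) A =
      μ (GLn.toMixed N L ⁻¹' A ∩ {y | GLn.sndHom N L y ∈ glFiniteIntegralLevel N L}) := by
  rw [Measure.map_apply (GLn.continuous_toMixed N L).measurable hA,
    Measure.restrict_apply (hA.preimage (GLn.continuous_toMixed N L).measurable)]

/-- The slab measure is left invariant: `((x,1) y)_∞ = x y_∞` and `(x, 1) · {y_f ∈ GL_N(𝒪̂)} = {y_f ∈ GL_N(𝒪̂)}`.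
[cite: BorelJacquet1979, §4.1] -/
theorem isMulLeftInvariant_map_toMixed_restrict
    [MeasurableSpace (GL (Fin N) (AdeleRing (𝓞 L) L))] [BorelSpace (GL (Fin N) (AdeleRing (𝓞 L) L))]
    [MeasurableSpace (GL (Fin N) (mixedSpace L))] [BorelSpace (GL (Fin N) (mixedSpace L))]
    (μ : Measure (GL (Fin N) (AdeleRing (𝓞 L) L))) [μ.IsMulLeftInvariant] :
    (Measure.map (GLn.toMixed N L) (μ.restrict {y | GLn.sndHom N L y ∈ glFiniteIntegralLevel N L})).IsMulLeftInvariant := by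
  refine ⟨fun x => Measure.ext fun A hA => ?_⟩
  rw [Measure.map_apply (measurable_const_mul x) hA, map_toMixed_restrict_apply μ hA,
    map_toMixed_restrict_apply μ (measurable_const_mul x hA)]
  have hset : GLn.toMixed N L ⁻¹' ((fun y => x * y) ⁻¹' A) ∩ {y | GLn.sndHom N L y ∈ glFiniteIntegralLevel N L} =
      (fun y => GLn.ofInfinite N L x * y) ⁻¹'
        (GLn.toMixed N L ⁻¹' A ∩ {y | GLn.sndHom N L y ∈ glFiniteIntegralLevel N L}) := by
    ext y
    simp only [mem_inter_iff, mem_preimage, map_mul, GLn.toMixed_ofInfinite, mem_setOf_eq, GLn.sndHom_ofInfinite, one_mul]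
  rw [hset, measure_preimage_mul]

/-- The slab measure is finite on compact sets (`{y_∞ ∈ C, y_f ∈ GL_N(𝒪̂)}` is compact). [cite: BorelJacquet1979, §4.1] -/
theorem isFiniteMeasureOnCompacts_map_toMixed_restrict
    [MeasurableSpace (GL (Fin N) (AdeleRing (𝓞 L) L))] [BorelSpace (GL (Fin N) (AdeleRing (𝓞 L) L))]
    [MeasurableSpace (GL (Fin N) (mixedSpace L))] [BorelSpace (GL (Fin N) (mixedSpace L))]
    (μ : Measure (GL (Fin N) (AdeleRing (𝓞 L) L))) [IsFiniteMeasureOnCompacts μ] :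
    IsFiniteMeasureOnCompacts
      (Measure.map (GLn.toMixed N L) (μ.restrict {y | GLn.sndHom N L y ∈ glFiniteIntegralLevel N L})) := by
  refine ⟨fun C hC => ?_⟩
  rw [map_toMixed_restrict_apply μ hC.isClosed.measurableSet]
  exact (isCompact_setOf_toMixed_mem_sndHom_mem (L := L) hC).measure_lt_top

/-- The slab measure is positive on non-empty open sets (`{y_∞ ∈ U, y_f ∈ GL_N(𝒪̂)}` is open and contains `(u, 1)`).
[cite: BorelJacquet1979, §4.1] -/
theorem isOpenPosMeasure_map_toMixed_restrict
    [MeasurableSpace (GL (Fin N) (AdeleRing (𝓞 L) L))] [BorelSpace (GL (Fin N) (AdeleRing (𝓞 L) L))]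
    [MeasurableSpace (GL (Fin N) (mixedSpace L))] [BorelSpace (GL (Fin N) (mixedSpace L))]
    (μ : Measure (GL (Fin N) (AdeleRing (𝓞 L) L))) [μ.IsOpenPosMeasure] :
    (Measure.map (GLn.toMixed N L) (μ.restrict {y | GLn.sndHom N L y ∈ glFiniteIntegralLevel N L})).IsOpenPosMeasure := by
  refine ⟨fun U hU hne => ?_⟩
  obtain ⟨u, hu⟩ := hne
  rw [map_toMixed_restrict_apply μ hU.measurableSet]
  have hopen : IsOpen (GLn.toMixed N L ⁻¹' U ∩ {y | GLn.sndHom N L y ∈ glFiniteIntegralLevel N L}) :=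
    (hU.preimage (GLn.continuous_toMixed N L)).inter isOpen_setOf_sndHom_mem
  have hmem : GLn.ofInfinite N L u ∈ GLn.toMixed N L ⁻¹' U ∩ {y | GLn.sndHom N L y ∈ glFiniteIntegralLevel N L} := by
    refine ⟨?_, ?_⟩
    · show GLn.toMixed N L (GLn.ofInfinite N L u) ∈ U
      rw [GLn.toMixed_ofInfinite]; exact hu
    · show GLn.sndHom N L (GLn.ofInfinite N L u) ∈ glFiniteIntegralLevel N L
      rw [GLn.sndHom_ofInfinite]; exact one_mem _
  exact hopen.measure_ne_zero μ ⟨_, hmem⟩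

/-- **The slab measure is a Haar measure.** For a Haar measure `μ` on `GL_N(𝔸_L)`, the push-forward along `y ↦ y_∞` of the
restriction of `μ` to the open set `{y_f ∈ GL_N(𝒪̂)}` is a Haar measure on `GL_N(L ⊗ ℝ)` (the device of ★ `levelArchMeasure`:
no product decomposition of `μ` is needed). [cite: BorelJacquet1979, §4.1] -/
theorem isHaarMeasure_map_toMixed_restrict
    [MeasurableSpace (GL (Fin N) (AdeleRing (𝓞 L) L))] [BorelSpace (GL (Fin N) (AdeleRing (𝓞 L) L))]
    [MeasurableSpace (GL (Fin N) (mixedSpace L))] [BorelSpace (GL (Fin N) (mixedSpace L))]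
    (μ : Measure (GL (Fin N) (AdeleRing (𝓞 L) L))) [μ.IsHaarMeasure] :
    (Measure.map (GLn.toMixed N L)
      (μ.restrict {y | GLn.sndHom N L y ∈ glFiniteIntegralLevel N L})).IsHaarMeasure :=
  have := isMulLeftInvariant_map_toMixed_restrict (L := L) (N := N) μ
  have := isFiniteMeasureOnCompacts_map_toMixed_restrict (L := L) (N := N) μ
  have := isOpenPosMeasure_map_toMixed_restrict (L := L) (N := N) μ
  {}

/-- **The slab is an archimedean height ball for the slab measure**:
`μ{y : H_∞(y) ≤ A ∧ y_f ∈ GL_N(𝒪̂)} = ((y ↦ y_∞)_* μ|_{y_f ∈ GL_N(𝒪̂)}) {x : H_∞((x, 1)) ≤ A}`. [cite: BorelJacquet1979, §1.2] -/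
theorem measure_slab_eq_map
    [MeasurableSpace (GL (Fin N) (AdeleRing (𝓞 L) L))] [BorelSpace (GL (Fin N) (AdeleRing (𝓞 L) L))]
    [MeasurableSpace (GL (Fin N) (mixedSpace L))] [BorelSpace (GL (Fin N) (mixedSpace L))]
    (μ : Measure (GL (Fin N) (AdeleRing (𝓞 L) L))) (A : ℝ) :
    μ {y | (GLn.archHeight N L y : ℝ) ≤ A ∧ GLn.sndHom N L y ∈ glFiniteIntegralLevel N L} =
      Measure.map (GLn.toMixed N L) (μ.restrict {y | GLn.sndHom N L y ∈ glFiniteIntegralLevel N L})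
        {x | (GLn.archHeight N L (GLn.ofInfinite N L x) : ℝ) ≤ A} := by
  have hcont : Continuous fun x : GL (Fin N) (mixedSpace L) => (GLn.archHeight N L (GLn.ofInfinite N L x) : ℝ) :=
    NNReal.continuous_coe.comp ((GLn.continuous_archHeight (n := N) (K := L)).comp (GLn.continuous_ofInfinite N L))
  have hA : MeasurableSet {x : GL (Fin N) (mixedSpace L) | (GLn.archHeight N L (GLn.ofInfinite N L x) : ℝ) ≤ A} :=
    measurableSet_le hcont.measurable measurable_const
  have hset : {y : GL (Fin N) (AdeleRing (𝓞 L) L) |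
      (GLn.archHeight N L y : ℝ) ≤ A ∧ GLn.sndHom N L y ∈ glFiniteIntegralLevel N L} =
      GLn.toMixed N L ⁻¹' {x | (GLn.archHeight N L (GLn.ofInfinite N L x) : ℝ) ≤ A} ∩
        {y | GLn.sndHom N L y ∈ glFiniteIntegralLevel N L} := by
    ext y
    simp only [mem_setOf_eq, mem_inter_iff, mem_preimage]
    rw [archHeight_ofInfinite_toMixed]
  rw [hset, map_toMixed_restrict_apply μ hA]

end Summit.HodgeConjecture.HodgeConjecture.Cruxes.HLiu418.K2LiuAdelicHeightBoxVolume

end
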